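import Mathlib.NumberTheory.Transcendental.Liouville.LiouvilleNumber
import Mathlib.RingTheory.Localization.Integral
import Mathlib.LinearAlgebra.FiniteDimensional.Lemmas
import Literature.Geometry.Kaehler.ComplexTorusWeilJ
import HarnessLib

/-!
# An explicit complex `4`-torus of Weil type with transcendental periods

Companion of `Literature/Geometry/Kaehler/ComplexTorusWeilJ.lean` (`J = diag(i, i, -i, -i)` on
`ℂ⁴`). C. Voisin, IMRN 2002 no. 20, §3 constructs her counterexample on "a general complex torus of
Weil type": `Γ = ℤ⁸` with a `ℤ[I]`-action, `X = Γ_ℂ/(W ⊕ Γ)` for a `4`-plane `W = W_i ⊕ W_{-i}`,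
`dim W_{±i} = 2`, "general enough". This file fixes ONE such torus explicitly, so that the tree's
`ComplexTorus Φ` machinery applies:

* `Weil.periodMap t : ℝ⁸ →ₗ[ℝ] ℂ⁴`, the real-linear period map with real parameter `t`,
  `x ↦ (ζ₀ + t ζ₂ + t² ζ₃, ζ₁ + t³ ζ₂ + t⁵ ζ₃, t¹⁰ ζ̄₀ + t²⁰ ζ̄₁ + ζ̄₂, t³⁰ ζ̄₀ + t⁵⁰ ζ̄₁ + ζ̄₃)`,
  `ζ_m = x_{2m} + i x_{2m+1}` (`Weil.zeta`): in Voisin's notation `Γ_ℝ ≅ ℂ⁴_ζ` through the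
  `ℤ[I]`-structure `I = Weil.rotMatrix` (`x_{2m} ↦ -x_{2m+1}`, `x_{2m+1} ↦ x_{2m}`), and
  `W_i`, `W̄_{-i}` are the graphs of the `2 × 4` matrices `P = (1 | T₁)`, `Q = (T₂ | 1)`,
  `T₁ = (t, t²; t³, t⁵)`, `T₂ = (t¹⁰, t²⁰; t³⁰, t⁵⁰)`;
* `Weil.periodMap_rotMatrix : periodMap t (I x) = J (periodMap t x)` — the lattice `ℤ⁸` is
  `ℤ[I]`-stable and `I` acts through `J = diag(i, i, -i, -i)`: a **lattice of Weil type**;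
* `Weil.periodMap_injective`: `periodMap t` is injective as soon as
  `p(t) = 1 - t¹¹ - t²³ - t³² - t⁵⁶ - t⁶⁵ + t⁶⁶ ≠ 0` (`p = det(1 - T₂ T₁)`, Voisin's condition
  `W ∩ Γ_ℝ = {0}`), in particular for transcendental `t` (`Weil.detPoly_aeval_ne_zero`);
* `Weil.tV = liouvilleNumber 3`, a transcendental real number (`Weil.transcendental_tV`, Mathlib's
  Liouville theorem), and **the period isomorphism** `Weil.periodEquiv : ℝ⁸ ≃L[ℝ] ℂ⁴`
  (`= periodMap tV`, `Weil.periodEquiv_apply`) with `Weil.periodEquiv_rotMatrix`; the torus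
  `ComplexTorus Weil.periodEquiv` is the explicit Weil torus of the discharge programme of
  `Literature.Barriers.HodgeConjecture.Voisin2002_weilTorus_hodgeClassWithoutSubvarieties`
  (transcendence of `t` is what makes `NS = 0` provable, in a later file).

No named fact is introduced; `periodMap`, `zeta`, `rotMatrix`, `detPoly`, `tV`, `periodEquiv` are
explicit.

## References

* C. Voisin, IMRN 2002 no. 20, 1057–1075 (arXiv:math/0112247), §3 (p. 5: `Γ`, `K = ℚ[I]`,
  `W = W_i ⊕ W_{-i}`, condition `W ∩ Γ_ℝ = {0}`), Prop. 3. [Voisin2002KaehlerCounterexample]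
* B. van Geemen, in LNM 1594 (1994), §5.2–5.3 (abelian varieties of Weil type, the matrices
  `(1 | T)`). [vanGeemen1994HodgeAV]
-/

noncomputable section

open scoped ComplexConjugate
open Polynomial

namespace Literature.Geometry.Kaehler

namespace Weil

/-! ### The complex lattice coordinates `ζ_m = x_{2m} + i x_{2m+1}` and the `ℤ[I]`-structure -/

/-- The complex coordinate `ζ_m(x) = x_{2m} + i x_{2m+1}` of `x ∈ ℝ⁸ = Γ_ℝ`, `m = 0, …, 3`
(Voisin's identification `Γ_ℚ = K⁴`, `K = ℚ[I]`). [cite: Voisin2002KaehlerCounterexample, §3 p. 5] -/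
def zeta (m : Fin 4) (x : Fin 8 → ℝ) : ℂ :=
  ![(⟨x 0, x 1⟩ : ℂ), ⟨x 2, x 3⟩, ⟨x 4, x 5⟩, ⟨x 6, x 7⟩] m

/-- `ζ₀(x) = x₀ + i x₁`. [folklore] -/
@[simp] theorem zeta_zero (x : Fin 8 → ℝ) : zeta 0 x = ⟨x 0, x 1⟩ := rfl
/-- `ζ₁(x) = x₂ + i x₃`. [folklore] -/
@[simp] theorem zeta_one (x : Fin 8 → ℝ) : zeta 1 x = ⟨x 2, x 3⟩ := rfl
/-- `ζ₂(x) = x₄ + i x₅`. [folklore] -/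
@[simp] theorem zeta_two (x : Fin 8 → ℝ) : zeta 2 x = ⟨x 4, x 5⟩ := rfl
/-- `ζ₃(x) = x₆ + i x₇`. [folklore] -/
@[simp] theorem zeta_three (x : Fin 8 → ℝ) : zeta 3 x = ⟨x 6, x 7⟩ := rfl

/-- **The `ℤ[I]`-structure on `Γ = ℤ⁸`**: the integer matrix `I` with `x_{2m} ↦ -x_{2m+1}`,
`x_{2m+1} ↦ x_{2m}` (multiplication by `i` on `ζ_m = x_{2m} + i x_{2m+1}`), `I² = -1`.
[cite: Voisin2002KaehlerCounterexample, §3 p. 5] -/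
def rotMatrix : Matrix (Fin 8) (Fin 8) ℤ :=
  !![0, -1, 0, 0, 0, 0, 0, 0;
     1, 0, 0, 0, 0, 0, 0, 0;
     0, 0, 0, -1, 0, 0, 0, 0;
     0, 0, 1, 0, 0, 0, 0, 0;
     0, 0, 0, 0, 0, -1, 0, 0;
     0, 0, 0, 0, 1, 0, 0, 0;
     0, 0, 0, 0, 0, 0, 0, -1;
     0, 0, 0, 0, 0, 0, 1, 0]

/-- `ζ_m(I x) = i ζ_m(x)`. [cite: Voisin2002KaehlerCounterexample, §3 p. 5] -/
theorem zeta_rotMatrix (m : Fin 4) (x : Fin 8 → ℝ) :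
    zeta m ((rotMatrix.map (Int.cast : ℤ → ℝ)).mulVec x) = Complex.I * zeta m x := by
  fin_cases m <;> apply Complex.ext <;>
    simp [rotMatrix, Matrix.mulVec, dotProduct, Fin.sum_univ_eight]

/-! ### The period map -/

/-- **The period map** `ℝ⁸ → ℂ⁴` with real parameter `t`:
`x ↦ (ζ₀ + t ζ₂ + t² ζ₃, ζ₁ + t³ ζ₂ + t⁵ ζ₃, t¹⁰ ζ̄₀ + t²⁰ ζ̄₁ + ζ̄₂, t³⁰ ζ̄₀ + t⁵⁰ ζ̄₁ + ζ̄₃)` — the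
first two coordinates span `ℂ²_i` (where `I` acts by `i`), the last two `ℂ²_{-i}`; the lattice is
`Γ = ℤ⁸`. [cite: Voisin2002KaehlerCounterexample, §3 p. 5] -/
def periodMap (t : ℝ) : (Fin 8 → ℝ) →ₗ[ℝ] (Fin 4 → ℂ) where
  toFun x := ![zeta 0 x + t * zeta 2 x + t ^ 2 * zeta 3 x,
    zeta 1 x + t ^ 3 * zeta 2 x + t ^ 5 * zeta 3 x,
    t ^ 10 * conj (zeta 0 x) + t ^ 20 * conj (zeta 1 x) + conj (zeta 2 x),
    t ^ 30 * conj (zeta 0 x) + t ^ 50 * conj (zeta 1 x) + conj (zeta 3 x)]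
  map_add' x y := by
    funext j
    fin_cases j <;> apply Complex.ext <;> simp <;> ring
  map_smul' r x := by
    funext j
    fin_cases j <;> apply Complex.ext <;> simp <;> ring

/-- The four components of the period map. [cite: Voisin2002KaehlerCounterexample, §3 p. 5] -/
theorem periodMap_apply (t : ℝ) (x : Fin 8 → ℝ) :
    periodMap t x = ![zeta 0 x + t * zeta 2 x + t ^ 2 * zeta 3 x,
      zeta 1 x + t ^ 3 * zeta 2 x + t ^ 5 * zeta 3 x,
      t ^ 10 * conj (zeta 0 x) + t ^ 20 * conj (zeta 1 x) + conj (zeta 2 x),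
      t ^ 30 * conj (zeta 0 x) + t ^ 50 * conj (zeta 1 x) + conj (zeta 3 x)] :=
  rfl

/-- **The lattice is of Weil type**: `periodMap t (I x) = J (periodMap t x)` — the `ℤ[I]`-action
on `Γ = ℤ⁸` becomes `J = diag(i, i, -i, -i)` on `V = ℂ⁴` (`\overline{i ζ} = -i ζ̄` on the last two
coordinates). [cite: Voisin2002KaehlerCounterexample, §3 p. 5] -/
theorem periodMap_rotMatrix (t : ℝ) (x : Fin 8 → ℝ) :
    periodMap t ((rotMatrix.map (Int.cast : ℤ → ℝ)).mulVec x) = J (periodMap t x) := by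
  rw [periodMap_apply, periodMap_apply]
  simp only [zeta_rotMatrix, map_mul, Complex.conj_I]
  funext j
  fin_cases j <;> simp <;> ring

/-! ### Injectivity: the determinant `det(1 - T₂ T₁)` -/

/-- The polynomial `p = 1 - X¹¹ - X²³ - X³² - X⁵⁶ - X⁶⁵ + X⁶⁶ = det(1 - T₂ T₁)`, whose
non-vanishing at `t` is Voisin's condition `W ∩ Γ_ℝ = {0}` for the period map.
[cite: Voisin2002KaehlerCounterexample, §3 p. 5] -/
def detPoly : ℚ[X] := 1 - X ^ 11 - X ^ 23 - X ^ 32 - X ^ 56 - X ^ 65 + X ^ 66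

/-- `p ≠ 0` (its constant coefficient is `1`). [folklore] -/
theorem detPoly_ne_zero : detPoly ≠ 0 := fun h ↦ by
  have h0 := congrArg (fun q : ℚ[X] ↦ q.coeff 0) h
  simp [detPoly] at h0

/-- `p(t) ≠ 0` for transcendental `t`. [folklore] -/
theorem detPoly_aeval_ne_zero {t : ℝ} (ht : Transcendental ℚ t) : aeval t detPoly ≠ 0 :=
  fun h ↦ ht ⟨detPoly, detPoly_ne_zero, h⟩

/-- `p(t)` written out. [folklore] -/
theorem detPoly_aeval (t : ℝ) :
    aeval t detPoly = 1 - t ^ 11 - t ^ 23 - t ^ 32 - t ^ 56 - t ^ 65 + t ^ 66 := by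
  simp [detPoly]

/-- **Injectivity of the period map** when `det(1 - T₂ T₁) = p(t) ≠ 0`: from `periodMap t x = 0`,
`ζ₀ = -t ζ₂ - t² ζ₃`, `ζ₁ = -t³ ζ₂ - t⁵ ζ₃` and (conjugating the last two coordinates)
`ζ₂ = -t¹⁰ ζ₀ - t²⁰ ζ₁`, `ζ₃ = -t³⁰ ζ₀ - t⁵⁰ ζ₁`, whence `(1 - T₂T₁)(ζ₂, ζ₃) = 0` and `p(t) ζ₂ =
p(t) ζ₃ = 0`. [cite: Voisin2002KaehlerCounterexample, §3 p. 5] -/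
theorem periodMap_injective {t : ℝ} (hp : aeval t detPoly ≠ 0) :
    Function.Injective (periodMap t) := by
  rw [detPoly_aeval] at hp
  refine (injective_iff_map_eq_zero _).2 fun x hx ↦ ?_
  have h0 := congrFun hx 0
  have h1 := congrFun hx 1
  have h2 := congrArg conj (congrFun hx 2)
  have h3 := congrArg conj (congrFun hx 3)
  simp only [periodMap_apply, Matrix.cons_val_zero, Matrix.cons_val_one, Matrix.cons_val,
    Pi.zero_apply, map_add, map_mul, Complex.conj_conj, Complex.conj_ofReal, map_pow,
    map_zero] at h0 h1 h2 h3
  set u := zeta 2 x with hu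
  set v := zeta 3 x with hv
  have hpu : ((1 - t ^ 11 - t ^ 23 - t ^ 32 - t ^ 56 - t ^ 65 + t ^ 66 : ℝ) : ℂ) * u = 0 := by
    push_cast
    linear_combination (1 - (t : ℂ) ^ 32 - (t : ℂ) ^ 55) * h2 + ((t : ℂ) ^ 12 + (t : ℂ) ^ 25) * h3
      - ((1 - (t : ℂ) ^ 32 - (t : ℂ) ^ 55) * (t : ℂ) ^ 10 + ((t : ℂ) ^ 12 + (t : ℂ) ^ 25) * (t : ℂ) ^ 30) * h0
      - ((1 - (t : ℂ) ^ 32 - (t : ℂ) ^ 55) * (t : ℂ) ^ 20 + ((t : ℂ) ^ 12 + (t : ℂ) ^ 25) * (t : ℂ) ^ 50) * h1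
  have hpv : ((1 - t ^ 11 - t ^ 23 - t ^ 32 - t ^ 56 - t ^ 65 + t ^ 66 : ℝ) : ℂ) * v = 0 := by
    push_cast
    linear_combination ((t : ℂ) ^ 31 + (t : ℂ) ^ 53) * h2 + (1 - (t : ℂ) ^ 11 - (t : ℂ) ^ 23) * h3
      - (((t : ℂ) ^ 31 + (t : ℂ) ^ 53) * (t : ℂ) ^ 10 + (1 - (t : ℂ) ^ 11 - (t : ℂ) ^ 23) * (t : ℂ) ^ 30) * h0
      - (((t : ℂ) ^ 31 + (t : ℂ) ^ 53) * (t : ℂ) ^ 20 + (1 - (t : ℂ) ^ 11 - (t : ℂ) ^ 23) * (t : ℂ) ^ 50) * h1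
  have hp' : ((1 - t ^ 11 - t ^ 23 - t ^ 32 - t ^ 56 - t ^ 65 + t ^ 66 : ℝ) : ℂ) ≠ 0 :=
    Complex.ofReal_ne_zero.2 hp
  have hu0 : u = 0 := (mul_eq_zero.1 hpu).resolve_left hp'
  have hv0 : v = 0 := (mul_eq_zero.1 hpv).resolve_left hp'
  rw [hu0, hv0] at h0 h1
  simp only [mul_zero, add_zero] at h0 h1
  have e0 := congrArg Complex.re h0
  have e1 := congrArg Complex.im h0
  have e2 := congrArg Complex.re h1
  have e3 := congrArg Complex.im h1
  have e4 := congrArg Complex.re hu0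
  have e5 := congrArg Complex.im hu0
  have e6 := congrArg Complex.re hv0
  have e7 := congrArg Complex.im hv0
  simp only [zeta_zero, zeta_one, Complex.zero_re, Complex.zero_im] at e0 e1 e2 e3 e4 e5 e6 e7
  funext j
  fin_cases j
  · exact e0
  · exact e1
  · exact e2
  · exact e3
  · exact e4
  · exact e5
  · exact e6
  · exact e7

/-- `dim_ℝ ℝ⁸ = dim_ℝ ℂ⁴`. [folklore] -/
theorem finrank_eq : Module.finrank ℝ (Fin 8 → ℝ) = Module.finrank ℝ (Fin 4 → ℂ) := by
  rw [Module.finrank_pi ℝ, Module.finrank_pi_fintype ℝ]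
  simp [Complex.finrank_real_complex]

/-! ### The transcendental parameter and the period isomorphism -/

/-- **The parameter**: the Liouville number `t = ∑_k 3^{-k!}`. [folklore] -/
def tV : ℝ := liouvilleNumber 3

/-- `t` is transcendental over `ℚ` (Liouville's theorem, Mathlib `transcendental_liouvilleNumber`,
from `ℤ` to `ℚ` by `IsFractionRing.isAlgebraic_iff`). [folklore] -/
theorem transcendental_tV : Transcendental ℚ tV := fun h ↦
  transcendental_liouvilleNumber (m := 3) (by norm_num) ((IsFractionRing.isAlgebraic_iff ℤ ℚ ℝ).2 h)

/-- `t`, viewed in `ℂ`, is transcendental over `ℚ`. [folklore] -/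
theorem transcendental_tV_complex : Transcendental ℚ (tV : ℂ) :=
  (transcendental_algebraMap_iff (R := ℚ) (S := ℝ) (A := ℂ) Complex.ofReal_injective).2
    transcendental_tV

/-- **The period isomorphism** `Φ : ℝ⁸ ≃ ℂ⁴` of the explicit Weil torus: `periodMap tV`, an
isomorphism since `p(tV) ≠ 0`. [cite: Voisin2002KaehlerCounterexample, §3 p. 5] -/
def periodEquiv : (Fin 8 → ℝ) ≃L[ℝ] (Fin 4 → ℂ) :=
  (LinearMap.linearEquivOfInjective (periodMap tV)
    (periodMap_injective (detPoly_aeval_ne_zero transcendental_tV)) finrank_eq).toContinuousLinearEquiv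

/-- `periodEquiv x = periodMap tV x`. [folklore] -/
@[simp] theorem periodEquiv_apply (x : Fin 8 → ℝ) : periodEquiv x = periodMap tV x := rfl

/-- **The explicit lattice is of Weil type**: `Φ (I x) = J (Φ x)` for the period isomorphism
`Φ = periodEquiv` and the integer matrix `I = rotMatrix` — the hypothesis `hA` of the
Weil-type statements of `Literature/Barriers/HodgeConjecture/KaehlerCoherentSheavesWeilClassProofs.lean`.
[cite: Voisin2002KaehlerCounterexample, §3 p. 5] -/
theorem periodEquiv_rotMatrix (x : Fin 8 → ℝ) :
    periodEquiv ((rotMatrix.map (Int.cast : ℤ → ℝ)).mulVec x) = J (periodEquiv x) := by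
  rw [periodEquiv_apply, periodEquiv_apply, periodMap_rotMatrix]

end Weil

end Literature.Geometry.Kaehler

end
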